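import Literature.MathematicalPhysics.QuantumFieldTheory.Balaban1983to89.B9LeafKnit
import Literature.MathematicalPhysics.QuantumFieldTheory.Balaban1983to89.B9LeafUnpinned

/-!
# `Balaban1983to89.B9LeafKnitNonVacuity` — DAG node N06 · [Balaban1985BackgroundPropagators]: the twenty-five displayed hypotheses of the knit
# `B9LeafKnit.b9_main_at_run_of_leaves` are JOINTLY SATISFIABLE together with the node's four antecedents at a world of record of NODE 00's Stage 2
# (kernel certificate that the knit is not an ex-falso shell), and the located converse of `…B9LeafUnpinned`: an inhabited bundle with UNBOUNDED M
# at which the whole extended leaf `DagBinding.B9LeafX` holds because its operators vanish — so N06 is UNDETERMINED over the Stage-2 frame and a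
# discharge must be read at the PIN's operators (ref-A's N06 guard in kernel form)

B9 = T. Bałaban, *Propagators for lattice gauge theories in a background field*, Commun. Math. Phys. **99** (1985) 389–434
[Balaban1985BackgroundPropagators]; [B6] = [Balaban1984PropagatorsII]; [B4] = [Balaban1983RegularityDecay]; [B5] = [Balaban1984PropagatorsI];
[B7] = [Balaban1985Averaging].

YM-PLAN Track A, node N06 (`Dag.B9_main ℓ := ℓ.b4 → ℓ.b5 → ℓ.b6 → ℓ.b7 → ℓ.b9`; leaf `b9 ↦ DagBinding.B9LeafX Y`).  Seat `pub-ymgap-dag-n06-a` (KNIT-BY-NAME),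
third module (companions: `…B9LeafKnit` p408821 — the knit; `…B9LeafUnpinned` p409350 — the leaf is refutable over an un-pinned bundle).  THEOREMS ONLY
(0 `def`, 0 `sorry`, standard axioms); every witness is built inside the proofs.

## WHAT IS CERTIFIED (kernel bookkeeping about the TYPED statements, nothing about Bałaban's objects)

* §1 `exists_isWorldOfRecord₂_knitHypotheses` — there are Stage-2 parameters of record `θ` (admissible, `D = 4`, coefficient algebra `ℂ`), bundles
  `X Y Z V W`, a world `w` with `w.up P = Upstream.ofPrintedAllXPN (Node00.carriers₂ θ X) Y Z V W` at every run (so `Node00.IsWorldOfRecord₂ w`: the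
  [B4] ∕ [B5] ∕ [B7] groups are the lineages' objects of record and `b4`, `b5`, `b7` HOLD there), an index map `ι` and a `U = 1` dictionary `Dict`, such
  that ALL displayed hypotheses of `B9LeafKnit.b9_main_at_run_of_leaves` hold SIMULTANEOUSLY — `hd`, `Dict`, the model signs `S`, the residual entries
  `ResidualGpAtOne` ∕ `ResidualGAGlobAtOne`, `0 < c35`, `hone`, and the sixteen whole-statement leaves `SectBStepPrinted`, `GaugeReduction335`,
  `Thm37Printed`, `Cor38Printed`, `Thm39Printed`, `Thm310Printed`, `RWSumsYieldIneqs`, `RWKernelSumYields`, `Thm311Printed`, `Thm312Printed`,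
  `Thm313Printed`, `Thm314Printed`, `Thm315FullPrinted`, `Stmt349Printed`, `Stmt3132Printed`, `B9Thm314.Thm314LocalPrinted` — AND the node's [B6]
  antecedent `DagBinding.B6BlockParam X.D6` holds as well, AND the B9 family index is INHABITED with `M` UNBOUNDED over the family (member `n : ℕ` has
  `M = n`, so every threshold «`M ≥ M₁`» of the leaves is met by some member: no threshold-vacuity).  The witness is DEGENERATE and says so in its
  statement: one coarse site, all lattice norms (3.39)–(3.41) `≡ 0`, ALL OPERATOR ENTRIES `≡ 0` (displayed conjunct), every abstract predicate
  (convergence, positivity, analyticity, (3.35)–(3.38)) `:= True`; the [B6] block of the run is the matching degenerate block (family `ℕ`, `M = n`,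
  (2.1)–(2.2) `:= True`, empty tree ∕ local-operator families, all kernels `0`).
* §2 consequences: `exists_isWorldOfRecord₂_allLeaves_b9_main` — at that Stage-2 world of record ALL FIVE leaves `b4 b5 b6 b7 b9` of the run hold, hence
  `Dag.B9_main` holds with every antecedent TRUE (the knit fires; its conclusion is not reached ex falso); with `B9LeafUnpinned.exists_isWorldOfRecord₂_not_b9_main`
  this gives `b9_main_undetermined_over_stage2` — over NODE 00's Stage-2 frame N06 is TRUE at some world of record and FALSE at another: neither `stub_N06`
  nor its negation is a theorem of the Stage-2 (or Stage-3, `B9LeafUnpinned.not_b6_and_b9_main_over_stage3`) frame; `exists_b9LeafX_of_vanishing_operators`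
  — the extended leaf holds at an INHABITED bundle with unbounded `M` whose operators vanish identically: inhabitation + thresholds met + `b6` met do NOT
  guard a discharge; only the PIN's operators and norms (Bałaban's G′(U), (Q′G′²Q′*)⁻¹, G, …, the norms (3.39)–(3.41)) give the leaf content — the
  kernel form of ref-A's N06 guard (pub-ymgap STATUS [REFA-G2-RANGE-READS-2] (4)).

HONEST FRAMING: count-neutral consistency ∕ independence bookkeeping over the typed leaf and NODE 00's staged predicates; N06 is NOT discharged (no B9
pin exists; eleven whole-statement leaves have no prover at any genuine carrier); nothing here is asserted about [B9] at Bałaban's objects; one finite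
T⁴ programme at fixed ε; nothing continuum ∕ ℝ⁴ ∕ OS ∕ mass-gap ∕ Clay.
-/

noncomputable section

namespace Literature.MathematicalPhysics.QuantumFieldTheory.Balaban1983to89.B9LeafKnitNonVacuity

open DagBinding DagDischargedII

/-! ## §1 Joint satisfiability of the knit's hypotheses at a Stage-2 world of record -/

/-- **The twenty-five displayed hypotheses of `B9LeafKnit.b9_main_at_run_of_leaves` are jointly satisfiable, together with the [B6] antecedent
`B6BlockParam X.D6`, at a world of record of NODE 00's Stage 2, over an INHABITED B9 bundle whose `M` is unbounded** — by the explicit degenerate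
witness described in the module docstring (all operator entries `≡ 0`, displayed; all norms `≡ 0`; abstract predicates `:= True`; every constant of
every leaf `:= 1`).  Consistency certificate only. [cite: Balaban1985BackgroundPropagators, Thms 3.1–3.4 pp.397–400, Cors. 3.5–3.6 pp.407–408, Thm 3.7 p.409, Cor. 3.8 p.410, Thms 3.9–3.11 pp.413–416, Thms 3.12–3.14 pp.423–427, Thm 3.15 p.432 (bookkeeping: the typed statements over a degenerate carrier bundle)] -/
theorem exists_isWorldOfRecord₂_knitHypotheses :
    ∃ (θ : Node00.Stage2Params) (X : PrintedCarriersR) (Y : PrintedCarriers9X) (Z : PrintedCarriers11) (V : PrintedCarriers14R)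
      (W : PrintedCarriers15) (w : WorldP) (ι : Y.I9 → X.D6.I)
      (_Dict : ∀ i : Y.I9, B9FromB6.DictAtOne (X.D6.geo (ι i)) (Y.geo9 i) (Y.bg9 i) (X.D6.Gp (ι i)) (X.D6.Cinv (ι i)) (X.D6.G (ι i))
        (Y.Gp i) (Y.GA i) (Y.Cinv i)),
      θ.toStage1Params.Admissible ∧ Node00.IsWorldOfRecord₂ w ∧
      (∀ P : B12.RunParams, w.up P = Upstream.ofPrintedAllXPN (Node00.carriers₂ θ X) Y Z V W) ∧
      Nonempty Y.I9 ∧ (∀ m : ℝ, ∃ i : Y.I9, m ≤ (Y.geo9 i).M) ∧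
      (∀ (i : Y.I9) (n : Fin 4) (U : (Y.bg9 i).Cfg) (lam : (Y.geo9 i).Loc) (y : (Y.geo9 i).Site), (Y.Gp i).e n U lam y = 0) ∧
      B6BlockParam X.D6 ∧ X.D6.d = Y.d9 ∧ (∀ i : Y.I9, B9FromB6.ModelSigns (Y.geo9 i)) ∧
      B9FromB6.ResidualGpAtOne Y.geo9 Y.bg9 Y.Gp ∧ B9FromB6.ResidualGAGlobAtOne Y.geo9 Y.bg9 Y.GA ∧ 0 < Y.c35 ∧
      (∀ i : Y.I9, ∀ α₀ : ℝ, 0 < α₀ → (Y.bg9 i).Reg335 Y.c35 α₀ (Y.bg9 i).one) ∧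
      B9.SectBStepPrinted Y.d9 Y.c35 Y.geo9 Y.bg9 Y.Gp Y.GA Y.Cinv Y.IsAnalyticExt ∧
      B9.GaugeReduction335 Y.d9 Y.c35 Y.geo9 Y.bg9 Y.InCube Y.Gp Y.GA Y.Cinv ∧
      B9.Thm37Printed Y.c35 Y.geo9 Y.bg9 Y.E37 ∧ B9.Cor38Printed Y.c35 Y.geo9 Y.bg9 Y.E37 ∧
      B9.Thm39Printed Y.d9 Y.c35 Y.geo9 Y.bg9 Y.EK39 ∧ B9.Thm310Printed Y.c35 Y.geo9 Y.bg9 Y.E310 ∧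
      B9.RWSumsYieldIneqs Y.geo9 Y.bg9 Y.E37 Y.E310 Y.Gp Y.GA ∧ B9.RWKernelSumYields Y.d9 Y.geo9 Y.bg9 Y.EK39 Y.Cinv ∧
      B9.Thm311Printed Y.c35 Y.geo9 Y.bg9 Y.PosDef ∧
      B9.Thm312Printed Y.d9 Y.c35 Y.geo9 Y.bg9 Y.GD Y.G₁ Y.H Y.H₁ Y.HasRWExp Y.HasRWExpH Y.PosDefK ∧
      B9.Thm313Printed Y.c35 Y.geo9 Y.bg9 Y.GG Y.HasRWExp Y.PosDefK ∧
      B9.Thm314Printed Y.c35 Y.geo9 Y.bg9 Y.Kdiff Y.dOmega ∧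
      B9.Thm315FullPrinted Y.c35 Y.geo9 Y.bg9 Y.Ck Y.inΛ Y.unitDist Y.GivenBy3185 Y.HasRWExpC ∧
      B9.Stmt349Printed Y.d9 Y.c35 Y.geo9 Y.bg9 Y.P349 ∧
      B9.Stmt3132Printed Y.d9 Y.c35 Y.geo9 Y.bg9 Y.QGQinv Y.QG1Qinv ∧
      B9Thm314.Thm314LocalPrinted Y.c35 Y.geo9 Y.bg9 Y.Kdiff Y.OmK Y.dOmega := by
  obtain ⟨θ, hθ, -⟩ := Node00.Stage1Params.exists_admissible
  obtain ⟨X₀⟩ := Node00.nonempty_printedCarriersR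
  obtain ⟨Z⟩ := Node00.nonempty_printedCarriers11
  obtain ⟨V⟩ := Node00.nonempty_printedCarriers14R
  obtain ⟨W⟩ := Node00.nonempty_printedCarriers15
  obtain ⟨w₀⟩ := Node00.nonempty_worldP
  -- the degenerate [B6] block: family index ℕ, member n with M = n, one coarse site, (2.1)–(2.2) := True, norms and kernels zero,
  -- empty families of lattice trees (Lemma 2.4) and of local operators (Prop. 2.5)
  let g₆ : ℕ → B6.Geometry := fun n =>
    { Site := PUnit, fin := inferInstance, scale := fun _ => 0, dist := fun _ _ => 0, k := 0, eta := 1, L := 1, R := 0, M := n,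
      Hyp21_22 := True, Loc := PUnit, suppIn := fun _ _ => True, supNorm := fun _ => 0, l2Norm := fun _ => 0, holder := fun _ _ => 0,
      Cut := PUnit, cutIn := fun _ _ => True, cutH := fun _ _ => 0, cutSup := fun _ => 0 }
  let D : B6.BlockData :=
    { I := ℕ, d := 4, L := 1, δ₀ := 1, geo := g₆, Gp := fun _ => ⟨fun _ _ _ => 0, fun _ _ _ => 0⟩, Cinv := fun _ => ⟨fun _ _ => 0⟩,
      G := fun _ => ⟨fun _ _ _ => 0, fun _ _ _ => 0, fun _ _ => 0, fun _ _ _ => 0, fun _ _ _ => 0⟩, Qinv := fun _ => ⟨fun _ _ => 0⟩,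
      H := fun _ => ⟨fun _ _ _ => 0, fun _ _ _ => 0⟩, J := PEmpty, tree := fun j => PEmpty.elim j, K := PEmpty,
      loc := fun j => PEmpty.elim j }
  -- the degenerate B9 bundle (as in `B9LeafUnpinned.exists_not_thm31Printed`, but with ALL operator entries zero)
  let g : ℕ → B9.Geometry := fun n =>
    { Site := PUnit, scale := fun _ => 0, dist := fun _ _ => 0, k := 0, eta := 1, L := 1, M := n, Loc := PUnit,
      suppIn := fun _ _ => True, suppInT := fun _ _ => True, supNorm := fun _ => 0, l2Norm := fun _ => 0, wNorm := fun _ _ => 0,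
      holder := fun _ _ => 0, Cut := PUnit, cutIn := fun _ _ => True, cutInT := fun _ _ => True, cutH := fun _ _ => 0,
      cutSup := fun _ => 0, suppInT_of_suppIn := fun _ _ h => h, cutInT_of_cutIn := fun _ _ h => h }
  let B : B9.Backgrounds :=
    { Cfg := PUnit, one := PUnit.unit, mul := fun _ _ => PUnit.unit, Reg335 := fun _ _ _ => True, Reg336 := fun _ _ _ => True,
      Cplx337 := fun _ _ _ => True, Cplx338 := fun _ _ _ => True }
  let K : ∀ n : ℕ, B9.KernelFamily (g n) B := fun _ =>
    { e := fun _ _ _ _ => 0, h1 := fun _ _ _ _ => 0, e4 := fun _ _ _ => 0, h2 := fun _ _ _ _ => 0, l2 := fun _ _ _ _ => 0,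
      glob := fun _ _ _ _ => 0 }
  let C : ∀ n : ℕ, B9.SiteKernel (g n) B := fun _ => ⟨fun _ _ _ => 0⟩
  let E : ∀ n : ℕ, B9.RWExpansion (g n) B := fun _ =>
    { Walk := PUnit, wlen := fun _ => 0, first := fun _ _ => True, last := fun _ _ => True, wdist := fun _ _ _ => 0,
      term := fun _ _ _ _ => 0, LocDep := fun _ _ => True, Converges := fun _ => True }
  let EK : ∀ n : ℕ, B9.RWKernelExpansion (g n) B := fun _ =>
    { Walk := PUnit, wlen := fun _ => 0, wdist := fun _ _ _ => 0, kterm := fun _ _ _ _ => 0, LocDep := fun _ _ => True,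
      Converges := fun _ => True }
  let Hk : ∀ n : ℕ, B9.HKernel (g n) B := fun _ => { e := fun _ _ _ _ => 0, h := fun _ _ _ _ => 0 }
  let P : ∀ n : ℕ, B9.FineKernel (g n) B := fun _ => ⟨fun _ _ _ _ => 0⟩
  -- the zero operators satisfy every inequality of (3.42)–(3.48), (3.132)–(3.133) with all constants 1
  have h342 : ∀ (n : ℕ) (U : B.Cfg), B9.Ineq342_346_347 (K n) 1 1 U := by
    intro n U
    refine ⟨?_, ?_, ?_⟩ <;> intros <;> simp [K, g]
  have h343 : ∀ (n : ℕ) (U : B.Cfg), B9.Ineq343_345 (K n) (fun _ => 1) (fun _ => 1) (fun _ _ => 1) 1 U := by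
    intro n U
    refine ⟨?_, ?_, ?_⟩ <;> intros <;> simp [K, g]
  have hnoLap : ∀ (n : ℕ) (U : B.Cfg), B9.Ineq342_346_347_noLap (K n) 1 1 U := fun n U => B9.noLap_of_full (K n) (h342 n U)
  have hC : ∀ (n : ℕ) (U : B.Cfg) (y y' : (g n).Site) (p q δ : ℝ),
      |(C n).ker U y y'| ≤ 1 * ((g n).len y) ^ p * ((g n).len y') ^ q * Real.exp (-(δ * (g n).dist y y')) := by
    intros; simp [C, g, B9.Geometry.len]
  have h3133 : ∀ (n : ℕ) (U : B.Cfg), B9.Ineq3133 4 (Hk n) 1 (fun _ => 1) 1 U := by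
    intro n U
    refine ⟨?_, ?_⟩ <;> intros <;> simp [Hk, g, B9.Geometry.len]
  have hAt : ∀ (n : ℕ) (U : B.Cfg), B9.Thms31to33IneqAt 4 (K n) (K n) (C n) 1 1 (fun _ => 1) (fun _ => 1) (fun _ _ => 1) 1 1 U :=
    fun n U => ⟨⟨h342 n U, h343 n U⟩, fun y y' => hC n U y y' _ _ _, h342 n U, h343 n U⟩
  have hwalk : ∀ n : ℕ, B9.walkFactor 1 1 (g n).M 1 0 0 = 1 := by
    intro n; simp [B9.walkFactor]
  -- the sixteen whole-statement leaves at the degenerate bundle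
  have hB : B9.SectBStepPrinted 4 1 g (fun _ => B) K K C (fun _ _ _ _ => True) := by
    intro B₀ δ₀ Bβ Bε Bεβ B₁ δ₁
    exact ⟨1, 1, 1, 1, 1, fun _ => 1, fun _ => 1, fun _ _ => 1, 1, 1, one_pos, one_pos, one_pos, one_pos, one_pos, one_pos, one_pos,
      fun n _ α₀ _ _ U _ _ α₁ _ _ => ⟨trivial, trivial, fun U' _ => hAt n _⟩⟩
  have hg : B9.GaugeReduction335 4 1 g (fun _ => B) (fun _ => True) K K C :=
    fun n _ α₀ U _ _ => ⟨PUnit.unit, trivial, fun _ _ _ _ _ _ _ h => h⟩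
  have t37 : B9.Thm37Printed 1 g (fun _ => B) E := ⟨1, 1, one_pos, one_pos, fun _ _ _ _ _ _ _ => trivial⟩
  have c38 : B9.Cor38Printed 1 g (fun _ => B) E :=
    ⟨1, 1, 1, 1, 1, one_pos, one_pos, one_pos, one_pos, one_pos, fun n _ α₀ _ _ U _ ω lam y y' _ _ _ => ⟨trivial, by simp [E, g]⟩⟩
  have t39 : B9.Thm39Printed 4 1 g (fun _ => B) EK := by
    refine ⟨1, 1, 1, 1, 1, one_pos, one_pos, one_pos, one_pos, one_pos, fun n _ α₀ _ _ U _ => ⟨trivial, fun ω y y' => ⟨trivial, ?_⟩⟩⟩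
    have h1 := hwalk n
    simp only [g] at h1
    simp [EK, g, B9.Geometry.len, h1]
  have t310 : B9.Thm310Printed 1 g (fun _ => B) E :=
    ⟨1, 1, 1, 1, 1, one_pos, one_pos, one_pos, one_pos, one_pos, fun n _ α₀ _ _ U _ =>
      ⟨trivial, fun ω J y y' _ _ _ => ⟨trivial, by simp [E, g]⟩⟩⟩
  have hsum : B9.RWSumsYieldIneqs g (fun _ => B) E E K K :=
    ⟨1, 1, fun _ => 1, fun _ => 1, fun _ _ => 1, one_pos, one_pos, fun n U => ⟨fun _ => ⟨h342 n U, h343 n U⟩, fun _ => ⟨h342 n U, h343 n U⟩⟩⟩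
  have hksum : B9.RWKernelSumYields 4 g (fun _ => B) EK C :=
    ⟨1, 1, one_pos, one_pos, fun n U _ y y' => hC n U y y' _ _ _⟩
  have t311 : B9.Thm311Printed 1 g (fun _ => B) (fun _ _ _ => True) := ⟨1, 1, one_pos, one_pos, fun _ _ _ _ _ _ _ _ => trivial⟩
  have t312 : B9.Thm312Printed 4 1 g (fun _ => B) K K Hk Hk (fun _ _ _ _ => True) (fun _ _ _ _ => True) (fun _ _ _ => True) := by
    refine ⟨1, 1, 1, 1, fun _ => 1, fun _ => 1, fun _ _ => 1, one_pos, one_pos, one_pos, one_pos, fun n _ α₀ _ _ U _ _ => ⟨?_, ?_⟩⟩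
    · intro K' hK'
      have hK'' : K' = K n := by simpa using hK'
      subst hK''
      exact ⟨hnoLap n U, h343 n U, trivial, trivial⟩
    · intro H' hH'
      have hH'' : H' = Hk n := by simpa using hH'
      subst hH''
      exact ⟨h3133 n U, trivial⟩
  have t313 : B9.Thm313Printed 1 g (fun _ => B) K (fun _ _ _ _ => True) (fun _ _ _ => True) :=
    ⟨1, 1, 1, 1, fun _ => 1, fun _ => 1, fun _ _ => 1, one_pos, one_pos, one_pos, one_pos, fun n _ α₀ _ _ U _ _ =>
      ⟨hnoLap n U, h343 n U, trivial, trivial⟩⟩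
  have t314 : B9.Thm314Printed 1 g (fun _ => B) K (fun _ _ _ => 0) := by
    refine ⟨1, 1, 1, 1, one_pos, one_pos, one_pos, one_pos, fun n _ α₀ _ _ U _ => ?_⟩
    intros; simp [K, g]
  have t315 : B9.Thm315FullPrinted 1 g (fun _ => B) C (fun _ _ => True) (fun _ _ _ => 0) (fun _ _ => True) (fun _ _ _ => True) := by
    refine ⟨1, 1, 1, one_pos, one_pos, one_pos, fun n α₀ _ _ U _ _ => ⟨trivial, trivial, fun y y' _ _ => ?_⟩⟩
    simp [C]
  have s349 : B9.Stmt349Printed 4 1 g (fun _ => B) P := by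
    refine ⟨1, 1, 1, 1, one_pos, one_pos, one_pos, one_pos, fun n _ α₀ _ _ U _ m y y' => ?_⟩
    fin_cases m <;> simp [P, g, B9.pref4inv, B9.Geometry.len]
  have s3132 : B9.Stmt3132Printed 4 1 g (fun _ => B) C C :=
    ⟨1, 1, 1, 1, one_pos, one_pos, one_pos, one_pos, fun n _ α₀ _ _ U _ _ =>
      ⟨fun y y' => hC n U y y' _ _ _, fun y y' => hC n U y y' _ _ _⟩⟩
  have t314loc : B9Thm314.Thm314LocalPrinted 1 g (fun _ => B) K (fun _ _ => True) (fun _ _ _ => 0) := by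
    refine ⟨1, 1, 1, 1, fun _ => 1, fun _ => 1, fun _ _ => 1, one_pos, one_pos, one_pos, one_pos, fun n _ α₀ _ _ U _ =>
      ⟨?_, ?_, ?_, ?_, ?_⟩⟩
    · simp [B9Thm314.IneqSupF, K, g]
    · simp [B9Thm314.IneqL2F, K, g]
    · intros; simp [K, g]
    · intros; simp [K, g]
    · intros; simp [K, g]
  -- the structural hypotheses of the knit
  have hS : ∀ n : ℕ, B9FromB6.ModelSigns (g n) := fun n =>
    ⟨zero_le_one, zero_le_one, fun _ _ => le_rfl, fun _ => le_rfl, fun _ => le_rfl, fun _ _ => le_rfl, fun _ _ => le_rfl,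
      fun _ _ _ _ => le_rfl, fun _ _ => le_rfl, fun _ => le_rfl⟩
  have hGp : B9FromB6.ResidualGpAtOne g (fun _ => B) K := by
    refine ⟨1, 1, 1, fun _ => 1, fun _ => 1, fun _ _ => 1, one_pos, one_pos, one_pos, fun n _ => ⟨?_, ?_, ?_, ?_, ?_⟩⟩
    · simp [B9FromB6.L2Block, K, g]
    · simp [B9FromB6.GlobBlock, K, g]
    · simp [B9FromB6.H1Block, K, g]
    · simp [B9FromB6.E4Block, K, g]
    · simp [B9FromB6.H2Block, K, g]
  have hGA : B9FromB6.ResidualGAGlobAtOne g (fun _ => B) K := by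
    refine ⟨1, 1, one_pos, one_pos, fun n _ => ?_⟩
    simp [B9FromB6.GlobBlock, K, g]
  -- the [B6] block holds at the degenerate block data
  have hD6 : B6BlockParam D := by
    refine ⟨⟨fun _ => 1, fun n _ α _ _ _ => ⟨?_, ?_⟩⟩, ?_, ?_, fun j => PEmpty.elim j, ?_, ?_, ?_, ?_⟩
    · intro y y'; simp [D, g₆]
    · intro y; simp [D, g₆]
    · refine ⟨1, 1, 1, fun _ => 1, one_pos, one_pos, one_pos, fun n _ _ => ⟨?_, ?_⟩⟩ <;> intros <;> simp [D, g₆]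
    · refine ⟨1, 1, 1, one_pos, one_pos, one_pos, fun n _ _ y y' => ?_⟩
      simp [D, g₆, B6.Geometry.len]
    · exact ⟨fun j => PEmpty.elim j, 1, 1, fun _ => 1, fun _ => 1, fun _ _ => 1, one_pos, one_pos, fun j => PEmpty.elim j⟩
    · refine ⟨1, 1, 1, fun _ => 1, fun _ => 1, fun _ _ => 1, one_pos, one_pos, one_pos, fun n _ _ => ⟨?_, ?_, ?_, ?_, ?_⟩⟩ <;>
        intros <;> simp [D, g₆]
    · refine ⟨1, 1, 1, one_pos, one_pos, one_pos, fun n _ _ b b' => ?_⟩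
      simp [D, g₆, B6.Geometry.len]
    · refine ⟨1, 1, 1, fun _ => 1, one_pos, one_pos, one_pos, fun n _ _ => ⟨?_, ?_⟩⟩ <;> intros <;> simp [D, g₆, B6.Geometry.len]
  -- the U = 1 dictionary between the degenerate block and the degenerate bundle: identities
  let Dict : ∀ n : ℕ, B9FromB6.DictAtOne (D.geo n) (g n) B (D.Gp n) (D.Cinv n) (D.G n) (K n) (K n) (C n) := fun n =>
    { site := fun y => y, loc := fun l => l, cut := fun c => c, hyp := trivial, M_eq := rfl, len_eq := fun _ => rfl,
      dist_eq := fun _ _ => rfl, supp := fun _ _ _ => trivial, suppT := fun _ _ _ => trivial, cutIn := fun _ _ _ => trivial,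
      cutT := fun _ _ _ => trivial, supNorm_eq := fun _ => rfl, l2Norm_eq := fun _ => rfl, holder_eq := fun _ _ => rfl,
      cutH_eq := fun _ _ => rfl, cutSup_eq := fun _ => rfl, Gp_e := fun _ _ _ => le_rfl, Gp_h1 := fun _ _ _ => le_rfl,
      C_ker := fun _ _ => le_rfl, GA_e := fun _ _ _ => le_rfl, GA_h1 := fun _ _ _ => le_rfl, GA_e4 := fun _ _ => le_rfl,
      GA_h2 := fun _ _ _ => le_rfl, GA_l2 := fun _ _ _ => le_rfl }
  -- assembling the bundle, the world and the witnesses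
  let Y : PrintedCarriers9X :=
    { I9 := ℕ, d9 := 4, c35 := 1, geo9 := g, bg9 := fun _ => B, InCube := fun _ => True, Gp := K, GA := K, Cinv := C,
      IsAnalyticExt := fun _ _ _ _ => True, E37 := E, EK39 := EK, E310 := E, PosDef := fun _ _ _ => True, GD := K, G₁ := K, H := Hk,
      H₁ := Hk, HasRWExp := fun _ _ _ _ => True, HasRWExpH := fun _ _ _ _ => True, PosDefK := fun _ _ _ => True, GG := K, Kdiff := K,
      dOmega := fun _ _ _ => 0, Ck := C, inΛ := fun _ _ => True, unitDist := fun _ _ _ => 0, GivenBy3185 := fun _ _ => True,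
      HasRWExpC := fun _ _ _ => True, P349 := P, QGQinv := C, QG1Qinv := C, OmK := fun _ _ => True }
  let θ₂ : Node00.Stage2Params := { θ with 𝔸 := ℂ }
  let X : PrintedCarriersR := Node00.withB6 X₀ D
  let w : WorldP := Node00.WorldP.withUp w₀ fun _ => Upstream.ofPrintedAllXPN (Node00.carriers₂ θ₂ X) Y Z V W
  refine ⟨θ₂, X, Y, Z, V, W, w, fun n => n, Dict, hθ, Node00.isWorldOfRecord₂_of_up θ₂ hθ X Y Z V W _ rfl, fun _ => rfl, ⟨(0 : ℕ)⟩,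
    fun m => ?_, fun _ _ _ _ _ => rfl, hD6, rfl, hS, hGp, hGA, one_pos, fun _ _ _ => trivial, hB, hg, t37, c38, t39, t310, hsum, hksum, t311,
    t312, t313, t314, t315, s349, s3132, t314loc⟩
  obtain ⟨n, hn⟩ := exists_nat_ge m
  exact ⟨n, hn⟩

/-! ## §2 Consequences: the knit fires with all antecedents true; N06 is undetermined over the Stage-2 frame; the guard -/

/-- **At some world of record of NODE 00's Stage 2, all five leaves `b4`, `b5`, `b6`, `b7`, `b9` of every run HOLD — hence node N06 holds there
with every antecedent TRUE** (`b4` ∕ `b5` ∕ `b7` from the Stage-2 objects of record, `b6` and the B9 leaf from the degenerate witness of §1 through the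
knit `B9LeafKnit.b9LeafX_of_b6BlockParam`): the knit's conclusion is reached with no false hypothesis and no false antecedent.  Consistency
certificate; the witness bundle is degenerate. [cite: Balaban1985BackgroundPropagators, Thms 3.1–3.15 pp.397–432 (bookkeeping over the typed leaf and NODE 00's Stage-2 predicate)] -/
theorem exists_isWorldOfRecord₂_allLeaves_b9_main :
    ∃ w : WorldP, Node00.IsWorldOfRecord₂ w ∧ ∀ P : B12.RunParams,
      (leavesP w P).b4 ∧ (leavesP w P).b5 ∧ (leavesP w P).b6 ∧ (leavesP w P).b7 ∧ (leavesP w P).b9 ∧ Dag.B9_main (leavesP w P) := by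
  obtain ⟨θ, X, Y, Z, V, W, w, ι, Dict, -, hw, hP, -, -, -, h6, hd, hS, hGp, hGA, hc, hone, hB, hg, t37, c38, t39, t310, hsum, hksum,
    t311, t312, t313, t314, t315, s349, s3132, t314loc⟩ := exists_isWorldOfRecord₂_knitHypotheses
  refine ⟨w, hw, fun P => ?_⟩
  have h4 : (leavesP w P).b4 := Node00.b4_main_of_isWorldOfRecord₂ w hw P
  have h5 : (leavesP w P).b5 := Node00.b5_main_of_isWorldOfRecord₂ w hw P h4
  have h7 : (leavesP w P).b7 := Node00.b7_main_of_isWorldOfRecord₂ w hw P h5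
  have h6' : (leavesP w P).b6 := (B9LeafKnit.leavesP_b6_iff (hP P)).2 h6
  have h9 : (leavesP w P).b9 :=
    (B9LeafKnit.leavesP_b9_iff (hP P)).2
      (B9LeafKnit.b9LeafX_of_b6BlockParam Y X.D6 hd ι Dict hS hGp hGA hc hone hB hg t37 c38 t39 t310 hsum hksum t311 t312 t313
        t314 t315 s349 s3132 t314loc h6)
  exact ⟨h4, h5, h6', h7, h9, B9LeafKnit.b9_main_of_b9 h9⟩

/-- **N06 is UNDETERMINED over NODE 00's Stage-2 frame**: `Dag.B9_main (leavesP w P)` holds at every run of SOME Stage-2 world of record (§1's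
degenerate bundle) and fails at every run of ANOTHER (`B9LeafUnpinned.exists_isWorldOfRecord₂_not_b9_main`).  Hence neither `stub_N06` nor its
negation is a theorem of that frame: the node must be read at a B9-PINNING stage (`B9LeafKnit.b9_main_of_pinnedB9`; R422). [cite: Balaban1985BackgroundPropagators, Thms 3.1–3.15 pp.397–432 (bookkeeping: independence of the typed node over the un-pinned frame)] -/
theorem b9_main_undetermined_over_stage2 :
    (∃ w : WorldP, Node00.IsWorldOfRecord₂ w ∧ ∀ P : B12.RunParams, Dag.B9_main (leavesP w P)) ∧
    (∃ w : WorldP, Node00.IsWorldOfRecord₂ w ∧ ∀ P : B12.RunParams, ¬ Dag.B9_main (leavesP w P)) := by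
  obtain ⟨w, hw, h⟩ := exists_isWorldOfRecord₂_allLeaves_b9_main
  exact ⟨⟨w, hw, fun P => (h P).2.2.2.2.2⟩, B9LeafUnpinned.exists_isWorldOfRecord₂_not_b9_main⟩

/-- **The guard, kernel form**: the whole extended leaf `B9LeafX Y` holds at an INHABITED bundle whose `M` is UNBOUNDED over the family and whose
operator entries VANISH identically (and whose [B6] antecedent is met) — the located converse of `B9LeafUnpinned.exists_not_b9LeafX` (there: norms
`0`, a sup entry `1`, leaf FALSE; here: norms `0`, entries `0`, leaf TRUE).  So the truth value of the typed leaf at an inhabited bundle is decided by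
the CONTENT of its operator and norm fields, never by inhabitation, met thresholds or a met `b6`: a «DISCHARGE CLAIMED n06» is read at the pin's
operators G′(U), (Q′G′²Q′*)⁻¹, G, … and the lattice norms (3.39)–(3.41) of record. [cite: Balaban1985BackgroundPropagators, (3.39)–(3.41) pp.396–397, Thms 3.1–3.15 pp.397–432 (bookkeeping: the typed leaf over a degenerate carrier bundle)] -/
theorem exists_b9LeafX_of_vanishing_operators :
    ∃ Y : PrintedCarriers9X, Nonempty Y.I9 ∧ (∀ m : ℝ, ∃ i : Y.I9, m ≤ (Y.geo9 i).M) ∧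
      (∀ (i : Y.I9) (n : Fin 4) (U : (Y.bg9 i).Cfg) (lam : (Y.geo9 i).Loc) (y : (Y.geo9 i).Site), (Y.Gp i).e n U lam y = 0) ∧
      B9LeafX Y := by
  obtain ⟨θ, X, Y, Z, V, W, w, ι, Dict, -, -, -, hI, hM, hzero, h6, hd, hS, hGp, hGA, hc, hone, hB, hg, t37, c38, t39, t310, hsum, hksum,
    t311, t312, t313, t314, t315, s349, s3132, t314loc⟩ := exists_isWorldOfRecord₂_knitHypotheses
  exact ⟨Y, hI, hM, hzero, B9LeafKnit.b9LeafX_of_b6BlockParam Y X.D6 hd ι Dict hS hGp hGA hc hone hB hg t37 c38 t39 t310 hsum hksum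
    t311 t312 t313 t314 t315 s349 s3132 t314loc h6⟩

end Literature.MathematicalPhysics.QuantumFieldTheory.Balaban1983to89.B9LeafKnitNonVacuity

end
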